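import Summits.AnomalousDissipation.AnomalousDissipation.Theorems.GalerkinSteadyZerothLaw.Negative.StokesStates
import Literature.Analysis.FluidPDE.NSGalerkinStationary

/-!
# Stub `stub_coatWitness` of the line `idea-sketch-ideator2` (card `euler-core-coat-readout`),
# crux stmt-AnomalousDissipation-2986 (`MirrorVariety.GalerkinSteadyZerothLaw`)

One amplitude-clamped coat over an Euler core yields one admissible Galerkin steady state of the core's force field.
Data: real solenoidal coefficient vectors `C, h ∈ galerkinSubspace (modes (Fin 3) N)`, a clamp viscosity `ν`, an
amplitude `α > 0` with `galerkinRHS S ν 0 (C + h) = (-(α²)) • C` (the unforced steady residual of `c := C + h` is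
collinear with the core), and an `L²` force `f` whose Fourier force vector on `modes N` is `C`.
* `coatWitness_coat_steady`: `galerkinRHS` is affine in the force and the Leray symbol fixes transversal vectors
  (`leraySym_of_transversal`), so `c` is an exact zero of the FORCED field `galerkinRHS S ν ((α²) • C)`.
* `coatWitness_gauge`: the Navier–Stokes scaling gauge `(c, ν, g) ↦ (α⁻¹ c, ν/α, α⁻² g)` maps Galerkin steady states
  to Galerkin steady states (`convectionCoeff_smul_left/right`, `leraySym_real_smul`); the gauged force is
  `(α²)⁻¹ • (α²) • C = C = forceCoeff (modes N) f`.
* The landed coefficient → field bridge `steadyState_fieldOf` (`Negative/StokesStates.lean`) turns the gauged zero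
  `α⁻¹ • (C + h) ∈ galerkinSubspace` into a `SteadyState (ν/α) N f (fieldOf N (α⁻¹ • (C + h)))`; Parseval
  (`integral_norm_sq_fieldOf`, `loudness_fieldOf`) and the homogeneity `energy (a • c) = a² energy c`,
  `dissipation ν (a • c) = a² dissipation ν c` give `∫|U|² = energy (C + h)/α²` and `(ν/α)‖∇U‖² = dissipation ν (C + h)/α³`.
-/

noncomputable section

-- `Summit.<Summit>.<Problem>` is the tree's mandated summit-side namespace (CONVENTIONS §2); deliberate duplicate.
set_option linter.dupNamespace false

open scoped InnerProductSpace Topology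
open MeasureTheory Filter Set UnitAddTorus
open Literature.Analysis.FunctionSpaces Literature.Analysis.FunctionSpaces.Torus
open Literature.Analysis.FluidPDE Literature.Analysis.FluidPDE.Torus

namespace Summit.AnomalousDissipation.AnomalousDissipation.Theorems.GalerkinSteadyZerothLaw

open Summit.AnomalousDissipation.AnomalousDissipation.Theorems.GalerkinSteadyZerothLaw.Negative
  (SteadyState BandLimited fieldOf steadyState_fieldOf integral_norm_sq_fieldOf loudness_fieldOf)
open Summit.AnomalousDissipation.AnomalousDissipation.Theorems.LaminarNeverLoud.Negative
  (modes forceCoeff energy dissipation modes_symm zero_not_mem_modes energy_nonneg dissipation_nonpos_of_nonpos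
    isRealCoeff_forceCoeff)

/-- A coat with readout `s` is an exact Galerkin steady state of the force `s • C`
(`galerkinRHS` is affine in the force and `Π C = C` for transversal `C`). [folklore] -/
theorem coatWitness_coat_steady {N : ℕ} {ν s : ℝ} {C h : ↥(modes (Fin 3) N) → EuclideanSpace ℂ (Fin 3)}
    (hC : C ∈ galerkinSubspace (modes (Fin 3) N))
    (hs : galerkinRHS (modes (Fin 3) N) ν 0 (C + h) = (-s) • C) :
    galerkinRHS (modes (Fin 3) N) ν (s • C) (C + h) = 0 := by
  funext k
  have hk := congrFun hs k
  have haff : galerkinRHS (modes (Fin 3) N) ν (s • C) (C + h) k =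
      galerkinRHS (modes (Fin 3) N) ν 0 (C + h) k +
        leraySym (k : Fin 3 → ℤ) (coeffExt (modes (Fin 3) N) (s • C) k) := by
    simp only [galerkinRHS_apply, galerkinField_def, coeffExt_zero, Pi.zero_apply, zero_sub, leraySym_sub,
      leraySym_neg]
    abel
  rw [haff, hk]
  simp only [Pi.smul_apply, Pi.zero_apply, coeffExt_coe, leraySym_real_smul,
    leraySym_of_transversal (hC.2 k), neg_smul, neg_add_cancel]

/-- **Scaling gauge** at the coefficient level: `(c, ν, g) ↦ (α⁻¹ c, ν/α, α⁻² g)` maps Galerkin steady states to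
Galerkin steady states (the field of the image is `α⁻²` times the original). [folklore] -/
theorem coatWitness_gauge {N : ℕ} {ν α : ℝ} {g c : ↥(modes (Fin 3) N) → EuclideanSpace ℂ (Fin 3)} (hα : 0 < α)
    (h0 : galerkinRHS (modes (Fin 3) N) ν g c = 0) :
    galerkinRHS (modes (Fin 3) N) (ν / α) ((α ^ 2)⁻¹ • g) (α⁻¹ • c) = 0 := by
  funext k
  have hk := congrFun h0 k
  rw [galerkinRHS_apply, galerkinField_def] at hk ⊢
  rw [coeffExt_smul, coeffExt_smul]
  set G := coeffExt (modes (Fin 3) N) g with hG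
  set Cc := coeffExt (modes (Fin 3) N) c with hCc
  have hα0 : α ≠ 0 := hα.ne'
  have hsc : (α⁻¹ • Cc : (Fin 3 → ℤ) → EuclideanSpace ℂ (Fin 3)) = ((α⁻¹ : ℝ) : ℂ) • Cc := by
    funext l; simp only [Pi.smul_apply, Complex.coe_smul]
  have hconv : convectionCoeff (modes (Fin 3) N) (α⁻¹ • Cc) (α⁻¹ • Cc) (k : Fin 3 → ℤ) =
      (α ^ 2)⁻¹ • convectionCoeff (modes (Fin 3) N) Cc Cc (k : Fin 3 → ℤ) := by
    rw [hsc, convectionCoeff_smul_left, convectionCoeff_smul_right, smul_smul, ← Complex.coe_smul]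
    congr 1
    push_cast
    ring
  have hstokes : -((((ν / α) * (4 * Real.pi ^ 2 * freqNormSq (k : Fin 3 → ℤ)) : ℝ) : ℂ) •
        (α⁻¹ • Cc) (k : Fin 3 → ℤ)) =
      (α ^ 2)⁻¹ • (-(((ν * (4 * Real.pi ^ 2 * freqNormSq (k : Fin 3 → ℤ)) : ℝ) : ℂ) • Cc (k : Fin 3 → ℤ))) := by
    rw [Pi.smul_apply, ← Complex.coe_smul, ← Complex.coe_smul, smul_smul, smul_neg, smul_smul, ← neg_smul, ← neg_smul]
    congr 1
    push_cast
    field_simp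
  rw [hconv, hstokes, Pi.smul_apply, ← smul_sub, leraySym_real_smul, ← smul_add, hk, Pi.zero_apply, smul_zero]

/-- Homogeneity of the coefficient energy: `energy (a • c) = a² · energy c`. [folklore] -/
theorem coatWitness_energy_smul {N : ℕ} (a : ℝ) (c : ↥(modes (Fin 3) N) → EuclideanSpace ℂ (Fin 3)) :
    energy (a • c) = a ^ 2 * energy c := by
  unfold energy
  rw [Finset.mul_sum]
  refine Finset.sum_congr rfl fun k _ => ?_
  rw [Pi.smul_apply, norm_smul, mul_pow, Real.norm_eq_abs, sq_abs]

/-- Homogeneity of the coefficient dissipation: `dissipation ν (a • c) = a² · dissipation ν c`. [folklore] -/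
theorem coatWitness_dissipation_smul {N : ℕ} (ν a : ℝ) (c : ↥(modes (Fin 3) N) → EuclideanSpace ℂ (Fin 3)) :
    dissipation ν (a • c) = a ^ 2 * dissipation ν c := by
  unfold dissipation
  have hsum : ∑ k : ↥(modes (Fin 3) N), freqNormSq (k : Fin 3 → ℤ) * ‖(a • c) k‖ ^ 2 =
      a ^ 2 * ∑ k : ↥(modes (Fin 3) N), freqNormSq (k : Fin 3 → ℤ) * ‖c k‖ ^ 2 := by
    rw [Finset.mul_sum]
    refine Finset.sum_congr rfl fun k _ => ?_
    rw [Pi.smul_apply, norm_smul, mul_pow, Real.norm_eq_abs, sq_abs]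
    ring
  rw [hsum]
  ring

/-- **stub_coatWitness** (M).  One coat yields one admissible state of the core's force field: if `C, h` are real
solenoidal at level `N`, the unforced residual of `C + h` at clamp viscosity `ν` is `-(α²) • C` with `α > 0`, and `f`
is an `L²` force whose Fourier vector on `modes N` is `C`, then `U := fieldOf N (α⁻¹ • (C + h))` is a `SteadyState`
of `f` at viscosity `ν/α` (`coatWitness_coat_steady` + `coatWitness_gauge` + `steadyState_fieldOf`) with
`∫|U|² = energy (C + h)/α²` and `(ν/α)‖∇U‖² = dissipation ν (C + h)/α³` (Parseval: `integral_norm_sq_fieldOf`,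
`loudness_fieldOf`). [folklore] -/
theorem stub_coatWitness : ∀ (N : ℕ) (C h : ↥(modes (Fin 3) N) → EuclideanSpace ℂ (Fin 3)) (ν α : ℝ)
    (f : UnitAddTorus (Fin 3) → EuclideanSpace ℝ (Fin 3)),
    C ∈ galerkinSubspace (modes (Fin 3) N) → h ∈ galerkinSubspace (modes (Fin 3) N) →
    galerkinRHS (modes (Fin 3) N) ν 0 (C + h) = (-(α ^ 2)) • C → 0 < α →
    MemLp f 2 volume → forceCoeff (modes (Fin 3) N) f = C →
    SteadyState (ν / α) N f (fieldOf N (α⁻¹ • (C + h))) ∧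
      ∫ x, ‖fieldOf N (α⁻¹ • (C + h)) x‖ ^ 2 = energy (C + h) / α ^ 2 ∧
      ν / α * gradNormSq (fieldOf N (α⁻¹ • (C + h))) = dissipation ν (C + h) / α ^ 3 := by
  intro N C h ν α f hC hh hres hα hf hfC
  have hα0 : α ≠ 0 := hα.ne'
  have hα2 : α ^ 2 ≠ 0 := pow_ne_zero 2 hα0
  have hc : C + h ∈ galerkinSubspace (modes (Fin 3) N) := (galerkinSubspace (modes (Fin 3) N)).add_mem hC hh
  have hc' : α⁻¹ • (C + h) ∈ galerkinSubspace (modes (Fin 3) N) :=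
    (galerkinSubspace (modes (Fin 3) N)).smul_mem α⁻¹ hc
  -- the coat is an exact steady state of the read-off force `(α²) • C` ...
  have hsteady : galerkinRHS (modes (Fin 3) N) ν ((α ^ 2) • C) (C + h) = 0 := coatWitness_coat_steady hC hres
  -- ... and the gauge turns it into a steady state of the force `C = forceCoeff (modes N) f` at viscosity `ν/α`
  have hgauged : galerkinRHS (modes (Fin 3) N) (ν / α) ((α ^ 2)⁻¹ • (α ^ 2) • C) (α⁻¹ • (C + h)) = 0 :=
    coatWitness_gauge hα hsteady
  rw [smul_smul, inv_mul_cancel₀ hα2, one_smul] at hgauged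
  have h1 : SteadyState (ν / α) N f (fieldOf N (α⁻¹ • (C + h))) :=
    steadyState_fieldOf hf hc' (by rw [hfC]; exact hgauged)
  refine ⟨h1, ?_, ?_⟩
  · rw [integral_norm_sq_fieldOf hc', coatWitness_energy_smul, inv_pow, div_eq_inv_mul]
  · rw [loudness_fieldOf (ν / α) hc', coatWitness_dissipation_smul]
    unfold dissipation
    field_simp

end Summit.AnomalousDissipation.AnomalousDissipation.Theorems.GalerkinSteadyZerothLaw

end

-- buildfix 2026-08-20 (ops-buildfix-1 gen 7): enqueue-only re-land — rebuild after B-35 (StokesArc, p233893) healed this module's import closure; no declaration changed.
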